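import Literature.NumberTheory.EllipticCurves.Kato2004.PerrinRiouRatio
import Literature.NumberTheory.EllipticCurves.Kato2004.AdmissibleZetaClass
import Literature.NumberTheory.EllipticCurves.Kato2004.AdmissibleZetaClassRealisabilityCM
import Literature.NumberTheory.EllipticCurves.MordellWeilTheoremProofs
import Summits.BirchSwinnertonDyer.Rank1Residual.Additive.KatoDescentAdmissibleIstarZero
import Summits.BirchSwinnertonDyer.Rank1Residual.Additive.KatoDescentLocPKummerLogExistence
import HarnessLib

set_option linter.dupNamespace false
set_option autoImplicit false

/-!
# `CccOneLawOnTypeIstarZero` (stmt-BirchSwinnertonDyer-19223), line `kato_perrin_riou_istar` v13 —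
# PRINT-BY-PROOF stub 1a `stub_hasPRRatioIstarZero` ((E) «`∃ ℒ, Kato2004.PRRatio W p ℒ`» on the rows) FROM TWO NAMED
# FACTS ALREADY IN THE LINE: F-CM `Kato2004.exists_isAdmissibleZetaClass_of_hasCM_of_irreducible` + GZK

Refill hand `leafhand-bsd-inertbadsignedbran-7` g0 (prover), 2026-08-31; DEF-FREE helper `--supports 19223 --as helper`.
Skeleton of record v13 `e3781ce8aaf94304` (planner bsd-cm-plan g40, D1177).  Nothing registered, no stub closed by this file
alone; BSD is proved for no curve.

## What this file proves (kernel)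

The closed predicate `Kato2004.PRRatio W p ℒ` («`ℒ` is the Perrin-Riou ratio of a VALUE-PINNED Kato zeta datum of `(W, p)`»,
`Kato2004/PerrinRiouRatio.lean`) is `PRRatioBody`: witnesses (Z0)–(Z5) (the newform, W2's datum `(ι, q, Λ)` with a rational
`q ≠ 0`, `DefinedExpStarBody` + the Tate-duality normalisation, Kato's guarded parameters with `R⁻_𝟙 ≠ 0`, THE family
`ZetaBody …`, a cyclotomic pin `(K, γ, I)` and THE `Λ`-adic lift `y ∈ I.H`), then a Kummer logarithm `t` of the bottom layer
of `y`, a generator `P` of `W(ℚ)` modulo torsion, the rational period ratio `λ = Ω⁺_f/Ω_W`, and `ℒ :=` the printed formula.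
The closed predicate `Kato2004.IsAdmissibleZetaClass W p K hK I z₀` (`Kato2004/AdmissibleZetaClass.lean`) is
`AdmissibleZetaClassBody`, whose witnesses (A0)–(A4) ARE (Z0)–(Z5) VERBATIM with the pin `(K, γ, I)` SHARED (module
docstring there: «(A0)–(A4) are `PRRatioBody`'s (Z0)–(Z5) with `(K, γ, I)` SHARED»), and whose (A6′) carries a period ratio
`perRatio` with `plusPeriod f = perRatio · W.realPeriodRat`.  Hence (§1, `exists_prRatioBody_of_admissibleZetaClassBody`,
pure re-packing of witnesses): an admissible class on a pin `I` with topological generator `γ`, a Kummer logarithm for the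
bottom layer of EVERY element of `I.H`, and a generator of `W(ℚ)` modulo torsion give `∃ ℒ, PRRatioBody W p ℒ`.  For ANY globally
minimal `W` of analytic rank one, GZK supplies both extra inputs (§3, `exists_prRatio_of_isAdmissibleZetaClass_of_gzk`: ONE admissible
class on a cyclotomic pin ⟹ `∃ ℒ, PRRatio W p ℒ` — row-agnostic, reusable by the `p = 7` twin line of crux 19945).  On the rows
`(p ≥ 5, I₀*, r_an = 1)` of the line (§4, `hasPRRatioIstarZero_of_facts`): the admissible class is the row lemma
`StrictCount.exists_isAdmissibleZetaClass_istarZero_of_cmFact` fed with F-CM (`W` is CM, `p` inert hence unramified in the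
CM field, `W[p]` irreducible on the type, `p ≠ 2`); the Kummer logarithm is the tree THEOREM `LocPKummer.logEx_of_gzk`
(Kato (14.9.3) ⊗ ℚ in positive rank, from GZK); the generator is Mordell–Weil (tree theorem
`WeierstrassCurve.exists_isMordellWeilBasis_holds`) at rank `W(ℚ) = r_an = 1` (GZK) — §2.  Both named facts are ALREADY
conjuncts of the line's cite stubs (`KatoPerrinRiouIstar.stub_printFactsKato.2.2.1`, `….stub_printInputsInert.2`), so the
registered signature of stub 1a is obtained as `hasPRRatioIstarZero_of_facts stub_printFactsKato.2.2.1 stub_printInputsInert.2`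
(the planner's call; this file registers nothing).

Honest label: CONDITIONAL on the two named facts (hypotheses `hFCM`, `hGZK`); (NV)/(VAL) (research stub 1b), 2c-T1/2c-T2 and
the cruxes are NOT touched; 19223 stays OPEN; Kato's Main Conjecture, Perrin-Riou's conjecture and BSD are not proved for any
curve.

References: [Kato2004Asterisque] Thm. 12.5 (1) (p. 221), §13.9 (p. 230), §14.9 (14.9.3) (p. 240), Prop. 15.21 (p. 266);
[BurnsKuriharaSano2019] §2.3, Hyp. 2.2 (p. 9), Conj. 2.8 (p. 10); [PerrinRiou1993AIF] §3.3; [BlochKato1990] Ex. 3.11;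
[SilvermanAEC2009] Thm. VIII.6.7; [GrossZagier1986] Thm. I.7.3; [Kolyvagin1990] Thm. A.
-/

noncomputable section

open scoped Classical NumberField

open WeierstrassCurve Field
open Literature.NumberTheory.EllipticCurves Literature.NumberTheory.EllipticCurves.Kato2004
open Summit.BirchSwinnertonDyer.Rank1Residual Summit.BirchSwinnertonDyer.Rank1Residual.Additive
open Summit.BirchSwinnertonDyer.Rank1Residual.X12.O10

namespace Summit.BirchSwinnertonDyer.BirchSwinnertonDyer.Theorems.CccOneHasPRRatio

/-! ## §1 Kernel: an admissible class on the pin carries every witness of `PRRatioBody` but the Kummer logarithm and the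
generator -/

/-- **`PRRatioBody` from `AdmissibleZetaClassBody` (pure re-packing).**  For `W/ℚ` globally minimal, a prime `p`, a cyclotomic
`ℤ_p`-extension `K` with topological generator `γ`, a pinned `𝐇¹_Γ(T_pW)` `I` and `z₀ ∈ I.H` with `AdmissibleZetaClassBody W p K hK I z₀`
(instance binders for the three `ℤ_p`-structure facts of `T_pW`, as in both bodies): if every element of `I.H` has a Kummer
logarithm at its bottom layer (`HasLocPKummerLog`) and `W(ℚ)` has a generator modulo torsion, then `∃ ℒ, PRRatioBody W p ℒ` —
the witnesses (Z0)–(Z5) and the period ratio are those of the admissible class, `ℒ` is the printed formula.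
[cite: Kato2004Asterisque, Thm. 12.5 (1) (p. 221), §13.9 (p. 230)] [cite: BurnsKuriharaSano2019, Conj. 2.8 (ii) (p. 10)] -/
theorem exists_prRatioBody_of_admissibleZetaClassBody
    {W : WeierstrassCurve ℚ} [W.IsElliptic] [W.IsGloballyMinimal] {p : ℕ} [Fact p.Prime]
    [ContinuousSMul ℤ_[p] (W.tateModule p)] [Module.Free ℤ_[p] (W.tateModule p)]
    [Module.Finite ℤ_[p] (W.tateModule p)] {K : ZpExtension ℚ p} {hK : K.IsCyclotomic}
    {γ : absoluteGaloisGroup ℚ} (hγ : K.IsTopGenerator γ) {I : IwasawaH1Data W p K γ} {z₀ : I.H}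
    (hz : AdmissibleZetaClassBody W p K hK I z₀)
    (hlog : ∀ y : I.H, ∃ t : ℚ_[p], HasLocPKummerLog W p (layerZeroToTop W p K (I.proj 0 y)) t)
    (hgen : ∃ P : W.toAffine.Point, ∀ Q : W.toAffine.Point, ∃ n : ℤ, IsOfFinAddOrder (Q - n • P)) :
    ∃ ℒ : ℚ_[p], PRRatioBody W p ℒ := by
  obtain ⟨hp, N, hN, f, hf, ι, q, Λ, hq, hZ, c, d₁, a, A, d', hA, hc, hd, hdd', hR, z, x, hzeta, y, hy,
    _qm, perRatio, _e, _u, _n₁, _n₂, _n₃, _n₄, _σc, _σd, _σℓ, -, -, -, -, -, -, -, -, -, -, hper, -,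
    -⟩ := hz
  obtain ⟨t, ht⟩ := hlog y
  obtain ⟨P, hP⟩ := hgen
  exact ⟨_, hp, N, hN, f, hf, ι, q, Λ, hq, hZ, c, d₁, a, A, d', hA, hc, hd, hdd', hR, z, x, hzeta,
    K, hK, γ, hγ, I, y, hy, t, P, perRatio, ht, hP, hper, rfl⟩

/-- **`∃ ℒ, PRRatio W p ℒ` from an admissible class** (closed forms): for `W/ℚ` globally minimal, `p` prime, a cyclotomic
pin `(K, γ, I)` with `K.IsTopGenerator γ`, an ADMISSIBLE Kato class `z₀ ∈ I.H` (`Kato2004.IsAdmissibleZetaClass`), Kummer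
logarithms on the bottom layer of `I.H` and a generator of `W(ℚ)` modulo torsion, SOME Perrin-Riou ratio of `(W, p)` exists.
[cite: Kato2004Asterisque, Thm. 12.5 (1) (p. 221), §13.9 (p. 230), §14.9 (14.9.3) (p. 240)] [cite: BurnsKuriharaSano2019, Conj. 2.8 (ii) (p. 10)] -/
theorem exists_prRatio_of_isAdmissibleZetaClass
    {W : WeierstrassCurve ℚ} [W.IsElliptic] [W.IsGloballyMinimal] {p : ℕ} [Fact p.Prime]
    [ContinuousSMul ℤ_[p] (W.tateModule p)] {K : ZpExtension ℚ p} {hK : K.IsCyclotomic}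
    {γ : absoluteGaloisGroup ℚ} (hγ : K.IsTopGenerator γ) {I : IwasawaH1Data W p K γ} {z₀ : I.H}
    (hz : IsAdmissibleZetaClass W p K hK I z₀)
    (hlog : ∀ y : I.H, ∃ t : ℚ_[p], HasLocPKummerLog W p (layerZeroToTop W p K (I.proj 0 y)) t)
    (hgen : ∃ P : W.toAffine.Point, ∀ Q : W.toAffine.Point, ∃ n : ℤ, IsOfFinAddOrder (Q - n • P)) :
    ∃ ℒ : ℚ_[p], PRRatio W p ℒ := by
  letI : Module.Free ℤ_[p] (W.tateModule p) := W.module_free_tateModule_holds p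
  letI : Module.Finite ℤ_[p] (W.tateModule p) := W.module_finite_tateModule_holds p
  obtain ⟨ℒ, hℒ⟩ := exists_prRatioBody_of_admissibleZetaClassBody hγ
    ((isAdmissibleZetaClass_iff W p K hK I z₀).mp hz) hlog hgen
  exact ⟨ℒ, prRatio_of_body hℒ⟩

/-! ## §2 A generator of `W(ℚ)` modulo torsion at Mordell–Weil rank one (tree Mordell–Weil theorem) -/

/-- **A generator modulo torsion from rank one.**  If `rank_ℤ W(K) = 1` (over a number field `K`) then some `P ∈ W(K)`
has `Q − n • P` torsion for every `Q ∈ W(K)` and a suitable `n ∈ ℤ` (Mordell–Weil: the classes of a Mordell–Weil basis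
form a `ℤ`-basis of `W(K)/W(K)_tors`, tree theorem `WeierstrassCurve.exists_isMordellWeilBasis_holds`).
[cite: SilvermanAEC2009, Thm. VIII.6.7] -/
theorem exists_generator_modTorsion_of_mordellWeilRank_eq_one {K : Type*} [Field K] [NumberField K]
    (X : WeierstrassCurve K) [X.IsElliptic] (h : X.mordellWeilRank = 1) :
    ∃ P : X.toAffine.Point, ∀ Q : X.toAffine.Point, ∃ n : ℤ, IsOfFinAddOrder (Q - n • P) := by
  obtain ⟨B, -, hBsp⟩ := X.exists_isMordellWeilBasis_holds
  let i0 : Fin X.mordellWeilRank := ⟨0, by omega⟩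
  have hsub : ∀ i : Fin X.mordellWeilRank, i = i0 := fun i => Fin.ext (by have := i.2; simp only [i0]; omega)
  refine ⟨B i0, fun Q => ?_⟩
  have hQ : (QuotientAddGroup.mk Q : mordellWeilModTorsion X) ∈
      Submodule.span ℤ (Set.range (QuotientAddGroup.mk ∘ B : Fin X.mordellWeilRank → mordellWeilModTorsion X)) := by
    rw [hBsp]; exact Submodule.mem_top
  have hrange : Set.range (QuotientAddGroup.mk ∘ B : Fin X.mordellWeilRank → mordellWeilModTorsion X) =
      {(QuotientAddGroup.mk (B i0) : mordellWeilModTorsion X)} := by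
    ext x
    simp only [Set.mem_range, Function.comp_apply, Set.mem_singleton_iff]
    constructor
    · rintro ⟨i, rfl⟩
      rw [hsub i]
    · rintro rfl
      exact ⟨i0, rfl⟩
  rw [hrange, Submodule.mem_span_singleton] at hQ
  obtain ⟨n, hn⟩ := hQ
  refine ⟨n, ?_⟩
  rw [← AddCommGroup.mem_torsion, ← QuotientAddGroup.eq_zero_iff, QuotientAddGroup.mk_sub,
    QuotientAddGroup.mk_zsmul, ← hn, sub_self]

/-- **The same over `ℚ`, in the group structure of `W(ℚ)` read through `ℚ`'s own decidable equality** (the currency of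
`Kato2004.PRRatioBody`'s generator clause; the generic lemma above is elaborated, like the tree's `MordellWeil.lean`, against
the classical instance — the two group laws agree, `DecidableEq ℚ` being a subsingleton). [cite: SilvermanAEC2009, Thm. VIII.6.7] -/
theorem exists_generator_modTorsion_rat (W : WeierstrassCurve ℚ) [W.IsElliptic] (h : W.mordellWeilRank = 1) :
    ∃ P : W.toAffine.Point, ∀ Q : W.toAffine.Point, ∃ n : ℤ, IsOfFinAddOrder (Q - n • P) := by
  obtain ⟨P, hP⟩ := exists_generator_modTorsion_of_mordellWeilRank_eq_one W h
  refine ⟨P, fun Q => ?_⟩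
  obtain ⟨n, hn⟩ := hP Q
  exact ⟨n, by convert hn⟩

/-! ## §3 Any globally minimal `W` of analytic rank one: an admissible class on a cyclotomic pin gives a Perrin-Riou ratio
(GZK supplies the Kummer logarithm and the generator) -/

/-- **`∃ ℒ, PRRatio W p ℒ` from ONE admissible class, granted GZK.**  For `W/ℚ` globally minimal of analytic rank one, any
prime `p`, any cyclotomic pin `(K, γ, I)` with `K.IsTopGenerator γ` and any ADMISSIBLE Kato class `z₀ ∈ I.H`: some Perrin-Riou
ratio of `(W, p)` exists.  GZK (`rank_eq_analyticRank_of_analyticRank_le_one`) gives Mordell–Weil rank one, hence the Kummer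
logarithm of the bottom layer of every element of `I.H` (tree theorem `LocPKummer.logEx_of_gzk`, Kato (14.9.3) ⊗ ℚ) and a
generator of `W(ℚ)` modulo torsion (§2); then §1.  Row-agnostic: serves every line that threads a realisation hypothesis
`∃ z₀, IsAdmissibleZetaClass W p K hK I z₀` (e.g. the `p = 7` twin `Lines/kato_perrin_riou_zp.lean` of crux 19945).
CONDITIONAL on `hGZK`; nothing else asserted. [cite: Kato2004Asterisque, Thm. 12.5 (1) (p. 221), §13.9 (p. 230), §14.9 (14.9.3) (p. 240)]
[cite: BurnsKuriharaSano2019, Hyp. 2.2 (p. 9) and Conj. 2.8 (p. 10)] [cite: GrossZagier1986, Thm. I.7.3] [cite: SilvermanAEC2009, Thm. VIII.6.7] -/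
theorem exists_prRatio_of_isAdmissibleZetaClass_of_gzk
    (hGZK : rank_eq_analyticRank_of_analyticRank_le_one)
    {W : WeierstrassCurve ℚ} [W.IsElliptic] [W.IsGloballyMinimal] {p : ℕ} [Fact p.Prime]
    [ContinuousSMul ℤ_[p] (W.tateModule p)] (hr : W.analyticRank = 1)
    {K : ZpExtension ℚ p} {hK : K.IsCyclotomic} {γ : absoluteGaloisGroup ℚ} (hγ : K.IsTopGenerator γ)
    {I : IwasawaH1Data W p K γ} {z₀ : I.H} (hz : IsAdmissibleZetaClass W p K hK I z₀) :
    ∃ ℒ : ℚ_[p], PRRatio W p ℒ := by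
  obtain ⟨hmw, -⟩ := hGZK W (by rw [hr])
  have hrk : W.mordellWeilRank = 1 := by rw [hmw, hr]
  exact exists_prRatio_of_isAdmissibleZetaClass hγ hz (LocPKummer.logEx_of_gzk hGZK W p K γ hK hγ hr I)
    (exists_generator_modTorsion_rat W hrk)

/-! ## §4 Stub 1a on the rows from F-CM + GZK -/

/-- **PRINT-BY-PROOF stub 1a `stub_hasPRRatioIstarZero` of `Lines/kato_perrin_riou_istar.lean` (v13) from the two named
facts F-CM and GZK** — conclusion = the REGISTERED SIGNATURE VERBATIM: at every rank-one pair of the signed type `(p, I₀*)`,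
`p ≥ 5`, SOME Perrin-Riou ratio `ℒ` of Kato's value-pinned zeta descent datum exists, `∃ ℒ : ℚ_[p], Kato2004.PRRatio W p ℒ`.
Proof: an admissible Kato class on some cyclotomic pin (`StrictCount.exists_isAdmissibleZetaClass_istarZero_of_cmFact` ⟸
F-CM = `Kato2004.exists_isAdmissibleZetaClass_of_hasCM_of_irreducible`: CM and `p` inert from the type, `W[p]` irreducible on
the type, `p ≠ 2`); then §3 (Kummer logarithms on the pin by `LocPKummer.logEx_of_gzk` ⟸ GZK; a generator of `W(ℚ)` modulo
torsion by §2 at Mordell–Weil rank `= r_an = 1`, GZK; §1).  CONDITIONAL on `hFCM` and `hGZK` (both already cite conjuncts of the line);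
nothing else asserted. [cite: Kato2004Asterisque, Thm. 12.5 (1) (p. 221), §13.9 (p. 230), §14.9 (14.9.3) (p. 240), Prop. 15.21 (p. 266)]
[cite: BurnsKuriharaSano2019, §2.3, Hyp. 2.2 (p. 9) and Conj. 2.8 (p. 10)] [cite: PerrinRiou1993AIF, §3.3]
[cite: GrossZagier1986, Thm. I.7.3] [cite: SilvermanAEC2009, Thm. VIII.6.7] -/
theorem hasPRRatioIstarZero_of_facts
    (hFCM : Kato2004.exists_isAdmissibleZetaClass_of_hasCM_of_irreducible)
    (hGZK : rank_eq_analyticRank_of_analyticRank_le_one) :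
    ∀ (p : ℕ) [Fact p.Prime], 5 ≤ p → ∀ (W : WeierstrassCurve ℚ) [W.IsElliptic] [W.IsGloballyMinimal],
      HasSignedLocalType W p (.Istar 0) → W.analyticRank = 1 →
      ∃ ℒ : ℚ_[p], Kato2004.PRRatio W p ℒ := by
  intro p _ hp5 W _ _ hT hr
  letI : ContinuousSMul ℤ_[p] (W.tateModule p) := TateModule.continuousSMul_padicInt
  -- an admissible Kato class on a cyclotomic pin (F-CM on the type); then §3 (GZK)
  obtain ⟨K, hK, γ, hγ, I, z₀, hz₀⟩ := StrictCount.exists_isAdmissibleZetaClass_istarZero_of_cmFact hFCM p hp5 W hT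
  exact exists_prRatio_of_isAdmissibleZetaClass_of_gzk hGZK hr hγ hz₀

end Summit.BirchSwinnertonDyer.BirchSwinnertonDyer.Theorems.CccOneHasPRRatio

end
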